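import Summits.BirchSwinnertonDyer.Rank1Residual.X2.GreenbergVatsalTorsion
import Literature.NumberTheory.EllipticCurves.SelmerCorankAssembly
import Literature.NumberTheory.EllipticCurves.GoodReductionUnramifiedProofs
import Literature.NumberTheory.EllipticCurves.IwasawaTowerTorsionOrdinaryProofs
import Literature.NumberTheory.GaloisRepresentations.DecompositionGroupOfCompletion
import Mathlib.Algebra.Ring.Action.Submonoid
import HarnessLib

/-!
# Greenberg–Vatsal Prop. (2.8) without `H⁰ = 0`, for `A = E[p^∞]`: the hypotheses discharged
# from tree theorems (continuity, divisibility, Néron–Ogg–Shafarevich VII.4.1(a)); over `ℚ_∞` at a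
# good ordinary `p` the correction term is `#E(ℚ)[p]`

HONEST FRAMING (cell `b2b-bsdres`, run/shared/lean/b2b/bsd-rank1-residual/, verbatim in every
file): the goal of the cell is to DELETE the COMBINATION-SHAPED residual classes of the
Birch–Swinnerton-Dyer formula for ALL analytic-rank `≤ 1` elliptic curves over `ℚ` — "full BSD
formula for every rank `≤ 1` curve in class `C`" assembled STRICTLY from published theorems — so
that the rank-`≤ 1` remainder becomes exactly the CONSTRUCTION-SHAPED classes, which are TYPED
(missing-input `Prop`s), NOT attempted. This is not "finishing BSD". Sub-cell
`b2b-bsdres-eisenstein-p2` (CLASS-OWNERS row "X2"), gen 8: research route; NO CLAIM BEYOND STATED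
CLASSES; nothing here changes a label. Theorems only (no `def`, no named fact, nothing asserted).

WHAT THIS FILE PROVES. The comparison theorems of `X2/GreenbergVatsalTorsion.lean` (referee R98.2
option (β), flag `GV-Prop28-H0-remark`) are stated for an abstract discrete `Γ_K`-module `M` under
four hypotheses. For `M = A = E[p^∞] = W.geomPrimaryTorsion p` of an elliptic curve `E/K` over a
number field, three of them are TREE THEOREMS and are discharged here:
* `hM` (continuity of `g ↦ g • m`) — `continuous_smul_geomPrimaryTorsion` (file
  `SelmerCorankAssembly`; `E(K̄)` is a discrete `Γ_K`-module);
* `hdiv` (`A` is `p`-divisible) — `exists_nsmul_eq_geomPrimaryTorsion` with the tree theorem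
  `zsmul_geomPoints_surjective_holds` (`[n] : E(K̄) → E(K̄)` is onto, Silverman III.4.2);
* `hunr` (`I_v` acts trivially on `A` at the finite `v ∉ Σ₀`, `v ∤ p`) — for `Σ₀ ⊇` the bad places
  prime to `p`, from `smul_eq_of_mem_inertia_of_nsmul_eq_zero` (Silverman VII.4.1(a), PROVED in the
  tree, `GoodReductionUnramifiedProofs`) through the identification of the tree's
  `GreenbergSelmer.inertia v` with `I_{𝔓₀}`, `𝔓₀ = adicCompletionPrime K v`
  (`inertia_adicCompletionPrime_eq_map_absInertia`, Neukirch II (9.6)): `inertia_smul_eq_of_good`.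
The fourth (`htriv`: `I_v` acts trivially on `A/A⁺_v` at `v ∣ p`) is GV's own hypothesis of
Prop. (2.8) ("Assume that `I_p` acts trivially on `D`"; good ordinary `D = Ẽ[p^∞]`, multiplicative
`D ≅ ℚ_p/ℤ_p(δ)`, GV pp. 14–15, 26) and stays a hypothesis on the Greenberg data, exactly as in GV.
Results:
* `invariants_eq_fixedPoints` — the correction group `invariants H A` of `TorsionComparison` IS
  Mathlib's `FixedPoints.addSubgroup H A = A^H = E(L)[p^∞]` used by the tree
  (`IwasawaTowerTorsion*Proofs`, `B = E[p^∞]^{Gal(K̄/K_∞)}`);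
* **`natCard_gvSelmer_torsion_curve`**: for every normal `H ≤ Γ_K`, Greenberg data `L` on `E[p^∞]`
  with `I_v` trivial on the graded pieces, and `Σ₀` containing the bad places prime to `p`:
  `#S^{Σ₀}_{E[p^∞][p]}(L) = #(S^{Σ₀}_{E[p^∞]}(L) ⊓ H¹(H, E[p^∞])[p]) · #(E(L)[p^∞] / p)` — NO
  hypothesis on `E(L)[p^∞]`; `natCard_gvSelmer_torsion_curve_of_finite`: `… · #E(L)[p^∞][p]` when
  `E(L)[p^∞]` is finite;
* **`natCard_gvSelmerInfty_torsion_rat_goodOrdinary`** (the X1-leaf setting of route G: `E/ℚ`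
  globally minimal, `p` odd good ORDINARY — anomalous allowed —, `κ` the cyclotomic
  `ℤ_p`-extension): `#S^{Σ₀}_{E[p^∞][p]}(ℚ_∞) = #(S^{Σ₀}_{E[p^∞]}(ℚ_∞) ⊓ H¹[p]) · #E(ℚ_∞)[p^∞][p]`
  with `E(ℚ_∞)[p^∞]` FINITE and `= E(ℚ)[p^∞]` by the tree theorems
  `finite_fixedPoints_kerSubgroup_geomPrimaryTorsion_of_ordinary` /
  `mem_fixedPoints_kerSubgroup_iff_of_isCyclotomic` (Mazur Prop. 6.12 / Greenberg LNM 1716 p. 62,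
  PROVED in `IwasawaTowerTorsionOrdinaryProofs`) — so the correction term is `#E(ℚ)[p]`, the
  referee's "kernel `E(ℚ)[p]`" (R98.2 (β)) on the nose; `natCard_fixedPoints_torsion_eq_rat` records
  `#E(ℚ_∞)[p^∞][p] = #{P ∈ E[p^∞] : Γ_ℚ-fixed, p P = 0}`.

References: Greenberg–Vatsal, Invent. Math. 142 (2000) = arXiv:math/9906215, §2 Prop. (2.8),
pp. 25–27; Silverman, *AEC*, VII.4.1, III.4.2; Greenberg, LNM 1716, §1 p. 62, §3 p. 86.
-/

noncomputable section

open scoped Classical AddSubgroup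

open NumberField IsDedekindDomain Field
open Literature.NumberTheory.EllipticCurves Literature.NumberTheory.EllipticCurves.GreenbergSelmer
  Literature.NumberTheory.GaloisRepresentations
  Summit.BirchSwinnertonDyer.Rank1Residual.X2.TorsionComparison
  Summit.BirchSwinnertonDyer.Rank1Residual.X2.GreenbergVatsalTorsion

universe u

namespace Summit.BirchSwinnertonDyer.Rank1Residual.X2.GreenbergVatsalTorsionCurve

/-! ## §1. `invariants = FixedPoints.addSubgroup` -/

/-- The invariants `M^G` of `TorsionComparison.invariants` are Mathlib's
`FixedPoints.addSubgroup G M` (same carrier). [folklore] -/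
theorem invariants_eq_fixedPoints {G : Type u} [Group G] {M : Type u} [AddCommGroup M]
    [DistribMulAction G M] : invariants G M = FixedPoints.addSubgroup G M :=
  AddSubgroup.ext fun m ↦ (mem_invariants_iff m).trans (FixedPoints.mem_addSubgroup G M m).symm

/-! ## §2. The hypotheses for `A = E[p^∞]` -/

section Hypotheses

variable {K : Type u} [Field K] [NumberField K] (W : WeierstrassCurve K) [W.IsElliptic]
  (p : ℕ) [Fact p.Prime]

omit [NumberField K] [W.IsElliptic] [Fact p.Prime] in
/-- `hM` for `E[p^∞]`: the orbit maps are continuous (tree: `continuous_smul_geomPrimaryTorsion`).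
[folklore] -/
theorem continuous_smul_curve (m : W.geomPrimaryTorsion p) :
    Continuous fun g : absoluteGaloisGroup K ↦ g • m :=
  W.continuous_smul_geomPrimaryTorsion p m

omit [NumberField K] in
/-- `hdiv` for `E[p^∞]`: `E[p^∞]` is `p`-divisible (tree: `exists_nsmul_eq_geomPrimaryTorsion` with
`zsmul_geomPoints_surjective_holds`, Silverman III.4.2).
[cite: SilvermanAEC2009, Prop. III.4.2(a)] -/
theorem divisible_curve (m : W.geomPrimaryTorsion p) : ∃ m' : W.geomPrimaryTorsion p, p • m' = m :=
  W.exists_nsmul_eq_geomPrimaryTorsion p W.zsmul_geomPoints_surjective_holds m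

omit [Fact p.Prime] in
/-- **`hunr` for `E[p^∞]` at a good place `v ∤ p`: the tree's inertia group
`GreenbergSelmer.inertia v` (`= I_{𝔓₀}`, `𝔓₀ = adicCompletionPrime K v`, Neukirch II (9.6)) acts
trivially on `E[p^∞]`** (Silverman VII.4.1(a), proved in the tree as
`smul_eq_of_mem_inertia_of_nsmul_eq_zero`). [cite: SilvermanAEC2009, Prop. VII.4.1(a)] -/
theorem inertia_smul_eq_of_good {v : HeightOneSpectrum (𝓞 K)} (hv : W.HasGoodReductionAt v)
    (hpv : ((p : ℕ) : 𝓞 K) ∉ v.asIdeal) {x : absoluteGaloisGroup K} (hx : x ∈ inertia v)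
    (m : W.geomPrimaryTorsion p) : x • m = m := by
  obtain ⟨σ, hσ, rfl⟩ := hx
  have hτ : absGaloisRestrict K (v.adicCompletion K) σ ∈
      (adicCompletionPrime K v).inertia (absoluteGaloisGroup K) := by
    rw [inertia_adicCompletionPrime_eq_map_absInertia]
    exact Subgroup.mem_map_of_mem _ hσ
  obtain ⟨k, hk⟩ := m.2
  have hn : (((p ^ k : ℕ) : 𝓞 K)) ∉ v.asIdeal := by
    rw [Nat.cast_pow]
    exact fun h ↦ hpv (v.isPrime.mem_of_pow_mem _ h)
  apply Subtype.ext
  rw [primaryComponent.coe_smul]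
  exact W.smul_eq_of_mem_inertia_of_nsmul_eq_zero hv hn (adicCompletionPrime_mem_primesAbove K v)
    hτ hk

omit [Fact p.Prime] in
/-- `hunr` packaged over a set `Σ₀` of finite places CONTAINING THE BAD PLACES PRIME TO `p`
(GV: `Σ₀ ⊇ Ram(A)`): `E[p^∞]` is unramified at every finite `v ∉ Σ₀`, `v ∤ p`.
[cite: SilvermanAEC2009, Prop. VII.4.1(a)] -/
theorem unramified_outside (S₀ : Set (HeightOneSpectrum (𝓞 K)))
    (hS : ∀ v : HeightOneSpectrum (𝓞 K), v ∉ S₀ → ((p : ℕ) : 𝓞 K) ∉ v.asIdeal →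
      W.HasGoodReductionAt v) :
    ∀ v : HeightOneSpectrum (𝓞 K), v ∉ S₀ → ((p : ℕ) : 𝓞 K) ∉ v.asIdeal →
      ∀ x ∈ inertia v, ∀ m : W.geomPrimaryTorsion p, x • m = m :=
  fun v hv hpv _ hx m ↦ inertia_smul_eq_of_good W p (hS v hv hpv) hpv hx m

end Hypotheses

/-! ## §3. The comparison for `E[p^∞]` over any `L = K̄^H` -/

section Curve

variable {K : Type u} [Field K] [NumberField K] (W : WeierstrassCurve K) [W.IsElliptic]
  (p : ℕ) [Fact p.Prime] (H : Subgroup (absoluteGaloisGroup K)) [H.Normal]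
  (L : Data K (W.geomPrimaryTorsion p) p) (S₀ : Set (HeightOneSpectrum (𝓞 K)))

/-- **GV Prop. (2.8) without `H⁰ = 0`, for `A = E[p^∞]` over `L = K̄^H`**: with `Σ₀` containing the
bad places prime to `p` (`hS`) and Greenberg data on whose graded pieces `I_v` acts trivially
(`htriv`, GV's hypothesis),
`#S^{Σ₀}_{E[p^∞][p]}(L) = #(S^{Σ₀}_{E[p^∞]}(L) ⊓ H¹(H, E[p^∞])[p]) · #(E(L)[p^∞] / p·E(L)[p^∞])`,
`E(L)[p^∞] = FixedPoints.addSubgroup H E[p^∞]`; NO hypothesis on `E(L)[p^∞]`.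
[cite: GreenbergVatsal2000, §2 Prop. (2.8) (proof, p. 25)] -/
theorem natCard_gvSelmer_torsion_curve
    (hS : ∀ v : HeightOneSpectrum (𝓞 K), v ∉ S₀ → ((p : ℕ) : 𝓞 K) ∉ v.asIdeal →
      W.HasGoodReductionAt v)
    (htriv : ∀ (v : HeightOneSpectrum (𝓞 K)) (hv : ((p : ℕ) : 𝓞 K) ∈ v.asIdeal),
      ∀ x ∈ inertia v, ∀ m : W.geomPrimaryTorsion p, x • m - m ∈ (L v hv).plus) :
    Nat.card (gvSelmer H ((W.geomPrimaryTorsion p)[(p : ℤ)]) p (torsionData L p) S₀) =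
      Nat.card (gvSelmer H (W.geomPrimaryTorsion p) p L S₀ ⊓
          (subgroupH1 H (W.geomPrimaryTorsion p))[(p : ℤ)] :
          AddSubgroup (subgroupH1 H (W.geomPrimaryTorsion p))) *
        Nat.card (FixedPoints.addSubgroup H (W.geomPrimaryTorsion p) ⧸
          (nsmulAddMonoidHom (α := FixedPoints.addSubgroup H (W.geomPrimaryTorsion p)) p).range) :=
  natCard_gvSelmer_torsion H (W.geomPrimaryTorsion p) p L S₀ p (continuous_smul_curve W p)
    (divisible_curve W p) (unramified_outside W p S₀ hS) htriv

/-- The same with `#(E(L)[p^∞]/p) = #E(L)[p^∞][p]` when `E(L)[p^∞]` is finite.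
[cite: GreenbergVatsal2000, §2 Prop. (2.8) (proof, p. 25)] -/
theorem natCard_gvSelmer_torsion_curve_of_finite
    (hS : ∀ v : HeightOneSpectrum (𝓞 K), v ∉ S₀ → ((p : ℕ) : 𝓞 K) ∉ v.asIdeal →
      W.HasGoodReductionAt v)
    (htriv : ∀ (v : HeightOneSpectrum (𝓞 K)) (hv : ((p : ℕ) : 𝓞 K) ∈ v.asIdeal),
      ∀ x ∈ inertia v, ∀ m : W.geomPrimaryTorsion p, x • m - m ∈ (L v hv).plus)
    [hfin : Finite (FixedPoints.addSubgroup H (W.geomPrimaryTorsion p))] :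
    Nat.card (gvSelmer H ((W.geomPrimaryTorsion p)[(p : ℤ)]) p (torsionData L p) S₀) =
      Nat.card (gvSelmer H (W.geomPrimaryTorsion p) p L S₀ ⊓
          (subgroupH1 H (W.geomPrimaryTorsion p))[(p : ℤ)] :
          AddSubgroup (subgroupH1 H (W.geomPrimaryTorsion p))) *
        Nat.card ((FixedPoints.addSubgroup H (W.geomPrimaryTorsion p))[(p : ℤ)]) := by
  haveI : Finite (invariants H (W.geomPrimaryTorsion p)) := hfin
  exact natCard_gvSelmer_torsion_of_finite H (W.geomPrimaryTorsion p) p L S₀ p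
    (continuous_smul_curve W p) (divisible_curve W p) (unramified_outside W p S₀ hS) htriv

end Curve

/-! ## §4. Over `ℚ_∞` at a good ordinary `p`: the correction term is `#E(ℚ)[p]` -/

section Rat

variable (W : WeierstrassCurve ℚ) [W.IsElliptic] [W.IsGloballyMinimal] {p : ℕ} [Fact p.Prime]
  (κ : ZpExtension ℚ p) (L : Data ℚ (W.geomPrimaryTorsion p) p)
  (S₀ : Set (HeightOneSpectrum (𝓞 ℚ)))

/-- **Route G's setting (X1 leaf): `E/ℚ` globally minimal, `p` odd of good ORDINARY reduction
(anomalous allowed), `κ` the cyclotomic `ℤ_p`-extension.** Then `E(ℚ_∞)[p^∞]` is finite (tree: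
`finite_fixedPoints_kerSubgroup_geomPrimaryTorsion_of_ordinary`, Mazur 6.12 / Greenberg p. 62) and
`#S^{Σ₀}_{E[p^∞][p]}(ℚ_∞) = #(S^{Σ₀}_{E[p^∞]}(ℚ_∞) ⊓ H¹(ℚ_∞, E[p^∞])[p]) · #E(ℚ_∞)[p^∞][p]`
for `Σ₀ ⊇` the bad primes `≠ p` and Greenberg data with `I_p` trivial on the graded piece.
[cite: GreenbergVatsal2000, §2 Prop. (2.8) (proof, p. 25)]
[cite: GreenbergLNM1716, §1 p. 62; §3 p. 86] -/
theorem natCard_gvSelmerInfty_torsion_rat_goodOrdinary (hp : p ≠ 2)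
    (hgood : W.HasGoodReductionAtPrime p) (hord : ¬ (p : ℤ) ∣ W.frobeniusTrace p)
    (hκ : κ.IsCyclotomic)
    (hS : ∀ v : HeightOneSpectrum (𝓞 ℚ), v ∉ S₀ → ((p : ℕ) : 𝓞 ℚ) ∉ v.asIdeal →
      W.HasGoodReductionAt v)
    (htriv : ∀ (v : HeightOneSpectrum (𝓞 ℚ)) (hv : ((p : ℕ) : 𝓞 ℚ) ∈ v.asIdeal),
      ∀ x ∈ inertia v, ∀ m : W.geomPrimaryTorsion p, x • m - m ∈ (L v hv).plus) :
    Nat.card (gvSelmerInfty κ ((W.geomPrimaryTorsion p)[(p : ℤ)]) (torsionData L p) S₀) =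
      Nat.card (gvSelmerInfty κ (W.geomPrimaryTorsion p) L S₀ ⊓
          (subgroupH1 κ.kerSubgroup (W.geomPrimaryTorsion p))[(p : ℤ)] :
          AddSubgroup (subgroupH1 κ.kerSubgroup (W.geomPrimaryTorsion p))) *
        Nat.card ((FixedPoints.addSubgroup κ.kerSubgroup (W.geomPrimaryTorsion p))[(p : ℤ)]) :=
  haveI := W.finite_fixedPoints_kerSubgroup_geomPrimaryTorsion_of_ordinary κ hp hgood hord hκ
  natCard_gvSelmer_torsion_curve_of_finite W p κ.kerSubgroup L S₀ hS htriv

/-- In that setting the correction group is `ℚ`-rational: `E(ℚ_∞)[p^∞][p] = {P ∈ E[p^∞] : Γ_ℚ P = P,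
p P = 0} = E(ℚ)[p]` inside `E[p^∞]` (tree: `mem_fixedPoints_kerSubgroup_iff_of_isCyclotomic`,
`E(ℚ_∞)[p^∞] = E(ℚ)[p^∞]`) — the referee's "kernel `E(ℚ)[p]`" (R98.2 (β)); on the X1 leaf's `φ = 1`
classes this is `ℤ/p` (a rational `p`-torsion point on `E₀`), `t = 1`.
[cite: GreenbergLNM1716, §1 p. 62; §3 p. 86] -/
theorem natCard_fixedPoints_torsion_eq_rat (hp : p ≠ 2)
    (hgood : W.HasGoodReductionAtPrime p) (hord : ¬ (p : ℤ) ∣ W.frobeniusTrace p)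
    (hκ : κ.IsCyclotomic) :
    Nat.card ((FixedPoints.addSubgroup κ.kerSubgroup (W.geomPrimaryTorsion p))[(p : ℤ)]) =
      Nat.card {m : W.geomPrimaryTorsion p //
        (∀ σ : absoluteGaloisGroup ℚ, σ • m = m) ∧ p • m = 0} := by
  have hfwd : ∀ x : (FixedPoints.addSubgroup κ.kerSubgroup (W.geomPrimaryTorsion p))[(p : ℤ)],
      (∀ σ : absoluteGaloisGroup ℚ, σ • (x.1.1 : W.geomPrimaryTorsion p) = x.1.1) ∧
        p • (x.1.1 : W.geomPrimaryTorsion p) = 0 := fun x ↦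
    ⟨(W.mem_fixedPoints_kerSubgroup_iff_of_isCyclotomic κ hp hgood hord hκ _).mp x.1.2, by
      rw [← AddSubgroupClass.coe_nsmul, ← AddSubgroupClass.coe_nsmul, AddSubgroup.torsionBy.nsmul x]
      rfl⟩
  have hbwd : ∀ y : {m : W.geomPrimaryTorsion p //
      (∀ σ : absoluteGaloisGroup ℚ, σ • m = m) ∧ p • m = 0},
      (⟨y.1, (W.mem_fixedPoints_kerSubgroup_iff_of_isCyclotomic κ hp hgood hord hκ _).mpr y.2.1⟩ :
        FixedPoints.addSubgroup κ.kerSubgroup (W.geomPrimaryTorsion p)) ∈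
        (FixedPoints.addSubgroup κ.kerSubgroup (W.geomPrimaryTorsion p))[(p : ℤ)] := fun y ↦
    AddSubgroup.torsionBy.nsmul_iff.mpr (Subtype.ext y.2.2)
  exact Nat.card_congr
    { toFun := fun x ↦ ⟨x.1.1, hfwd x⟩
      invFun := fun y ↦ ⟨⟨y.1, _⟩, hbwd y⟩
      left_inv := fun x ↦ Subtype.ext (Subtype.ext rfl)
      right_inv := fun y ↦ Subtype.ext rfl }

end Rat

end Summit.BirchSwinnertonDyer.Rank1Residual.X2.GreenbergVatsalTorsionCurve

end
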